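import Literature.Geometry.Kaehler.ComplexTorusIntegralHodgeLatticePrimitiveSplitting
import HarnessLib

/-!
# The Lefschetz part of the integral Hodge lattice is the saturation of `θ ∧ Hdgᵖ(X, ℤ)`:
# `(Hdgᵖ⁺¹(X, ℤ)_prim)^⊥ = {x ∈ Hdgᵖ⁺¹(X, ℤ) : N·x ∈ θ ∧ Hdgᵖ(X, ℤ) for some N ≥ 1}`

Layer `Literature/Geometry/Kaehler`, namespace `Literature.Geometry.Kaehler.ComplexTorus`; lane `lit-hodgefound`
(Track 2 foundations library), seat p09, generation 46, row g46-#11. THEOREMS ONLY (0 definitions); no named fact, net debt 0.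
Completes g46-#9 (`ComplexTorusIntegralHodgeLatticePrimitiveSplitting`: inside `M = Hdgᵖ⁺¹(X, ℤ)` the primitive Hodge lattice `P` and its
`B_{2p+2}`-orthogonal `P^⊥` span a sublattice of finite index; `θ ∧ H^{2p}(X, ℤ) ∩ Hdgᵖ⁺¹(X, ℤ) ⊆ P^⊥`) by the converse inclusion, so that
the Lefschetz part `P^⊥` is identified: **`x ∈ P^⊥` iff a positive multiple of `x` is `β ∧ θ` with `β ∈ Hdgᵖ(X, ℤ)`** — over `ℚ` this is the
orthogonal Lefschetz decomposition of the Hodge classes `Bᵖ⁺¹(X) = Bᵖ⁺¹(X)_prim ⊕ L Bᵖ(X)` (Voisin: Lemma 6.31, Rem. 6.27; Lange §7.3.2 (3)), over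
`ℤ` it says that `P^⊥` is the SATURATION of `θ ∧ Hdgᵖ(X, ℤ)` in `Hdgᵖ⁺¹(X, ℤ)`. The proof is integral throughout: by g45-#3
(`IsPolarizationType.exists_nsmul_eq_primitive_add_wedge_ofRealForm`) `N·x = y₀ + β ∧ θ` with `y₀` a PRIMITIVE integral Hodge class and
`β ∈ Hdgᵖ(X, ℤ)`; `β ∧ θ ∈ P^⊥` (g46-#9), so `B(y₀, y₀) = B(y₀, N·x) − B(y₀, β ∧ θ) = 0` for `x ∈ P^⊥`, and Hodge–Riemann over `ℤ`
(`(−1)ᵖ⁺¹·s·B` is positive on `P ∖ 0`, g45-#2 / g46-#9) forces `y₀ = 0`.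

## What is proved

* `IsPolarizationType.exists_nsmul_eq_wedge_ofRealForm_of_mem_orthogonal_primitive`: **`x ∈ P^⊥ ⟹ ∃ N ≥ 1, ∃ β ∈ Hdgᵖ(X, ℤ), N·x = β ∧ θ`**.
* `IsPolarizationType.mem_orthogonal_primitive_of_nsmul_eq_wedge_ofRealForm`: conversely `N·x = β ∧ θ` (`N ≥ 1`, `β ∈ H^{2p}(X, ℤ)`) gives `x ∈ P^⊥`
  (`P^⊥` is saturated).
* **`IsPolarizationType.mem_orthogonal_primitive_iff_exists_nsmul_eq_wedge_ofRealForm`**: the characterisation of the Lefschetz part,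
  `P^⊥ = (θ ∧ Hdgᵖ(X, ℤ))^{sat}`.

## Dictionary

As in g46-#9 with `m = 2p`: `X` polarised of type `d` (`g = j + 2`), degree `2p + 2` with `2p + 2 + q = g`, `B = B_{2p+2} = ⟨·, γ_q ∧ ·⟩` on
`H^{2p+2}(X, ℤ)` (`hB`), `M = AddSubgroup.toIntSubmodule ((integralHodgeClassesIn Φ (2p+2) (p+1)).addSubgroupOf (integralForms Φ (2p+2)))`,
`P : Submodule ℤ M` the primitive classes (`hP`), `P^⊥ = (B.restrict M).orthogonal P`.

## References

* [cite: VoisinHodgeI2002, §6.2.3 Rem. 6.27 (PDF p. 126); §6.3.2 Lemma 6.31, Thm. 6.32 (PDF p. 128); §7.1.2 (PDF p. 134)]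
* [cite: Lange2023AbelianVarietiesComplex, §5.4.1 (5.22)–(5.23) (PDF p. 275); §7.2.2; §7.3.2 (3)]
* [cite: Kitaoka1993, Ch. 5 Prop. 5.3.3 (proof)]
-/

noncomputable section

-- `Module ℂ` / `SMulZeroClass ℂ` synthesis on `E [⋀^Fin k]→L[ℝ] ℂ` (as in `ComplexTorusLefschetzDecomposition`)
set_option maxSynthPendingDepth 3

open Module Function Complex
open LinearMap (BilinForm)
open Literature.LinearAlgebra.Alternating
open Literature.Analysis.Complex (IsOfTypeAt typeSubmodule)

namespace Literature.Geometry.Kaehler.ComplexTorus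

section Saturation

variable {ι : Type*} [Fintype ι] [DecidableEq ι] {E : Type*} [NormedAddCommGroup E] [NormedSpace ℂ E]
  {Φ : (ι → ℝ) ≃L[ℝ] E} {j n q p : ℕ} {η : E [⋀^Fin 2]→L[ℝ] ℝ} {d : Fin (j + 2) → ℕ}

set_option maxHeartbeats 4000000 in
/-- **`P^⊥ ⊆ (θ ∧ Hdgᵖ(X, ℤ))^{sat}`**: every integral Hodge class `x ∈ Hdgᵖ⁺¹(X, ℤ)` which is `B_{2p+2}`-orthogonal to all PRIMITIVE integral Hodge
classes has a positive multiple of the form `N·x = β ∧ θ` with `β ∈ Hdgᵖ(X, ℤ)` an integral Hodge class one codimension down (`N·x = y₀ + β ∧ θ`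
integrally with `y₀` primitive; `B(y₀, y₀) = 0` since `x, β ∧ θ ∈ P^⊥`; Hodge–Riemann over `ℤ` gives `y₀ = 0`).
[cite: VoisinHodgeI2002, §6.3.2 Lemma 6.31, Thm. 6.32 (PDF p. 128); §6.2.3 Rem. 6.27] [cite: Lange2023AbelianVarietiesComplex, §7.3.2 (3); §5.4.1 (5.22)] -/
theorem IsPolarizationType.exists_nsmul_eq_wedge_ofRealForm_of_mem_orthogonal_primitive (hd : IsPolarizationType Φ η d)
    (hη : IsRiemannForm Φ η) (hkq : 2 * p + 2 + q = j + 2) (hq : q ≤ j + 2) {γ : E [⋀^Fin (2 * q)]→L[ℝ] ℂ}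
    (hγ : wedgePow (ofRealForm η) q = ((q.factorial * ∏ i : Fin q, d (Fin.castLE hq i) : ℕ) : ℂ) • γ)
    (e : Fin n ≃ ι) (hn : 2 * p + 2 + (2 * q + (2 * p + 2)) = n) {B : BilinForm ℤ ↥(integralForms Φ (2 * p + 2))}
    (hB : ∀ x y : ↥(integralForms Φ (2 * p + 2)),
      ((B x y : ℤ) : ℂ) = poincarePairing Φ e hn (x : E [⋀^Fin (2 * p + 2)]→L[ℝ] ℂ) (γ.wedge (y : E [⋀^Fin (2 * p + 2)]→L[ℝ] ℂ)))
    {P : Submodule ℤ ↥(AddSubgroup.toIntSubmodule ((integralHodgeClassesIn Φ (2 * p + 2) (p + 1)).addSubgroupOf (integralForms Φ (2 * p + 2))))}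
    (hP : ∀ z, z ∈ P ↔ (((z : ↥(AddSubgroup.toIntSubmodule ((integralHodgeClassesIn Φ (2 * p + 2) (p + 1)).addSubgroupOf
      (integralForms Φ (2 * p + 2))))) : ↥(integralForms Φ (2 * p + 2))) : E [⋀^Fin (2 * p + 2)]→L[ℝ] ℂ) ∈ primitiveForms η (2 * p + 2))
    {x : ↥(AddSubgroup.toIntSubmodule ((integralHodgeClassesIn Φ (2 * p + 2) (p + 1)).addSubgroupOf (integralForms Φ (2 * p + 2))))}
    (hx : x ∈ (B.restrict (AddSubgroup.toIntSubmodule ((integralHodgeClassesIn Φ (2 * p + 2) (p + 1)).addSubgroupOf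
      (integralForms Φ (2 * p + 2))))).orthogonal P) :
    ∃ N : ℕ, 0 < N ∧ ∃ β ∈ integralHodgeClassesIn Φ (2 * p) p,
      (N : ℂ) • ((x : ↥(integralForms Φ (2 * p + 2))) : E [⋀^Fin (2 * p + 2)]→L[ℝ] ℂ) = β.wedge (ofRealForm η : E [⋀^Fin 2]→L[ℝ] ℂ) := by
  haveI : FiniteDimensional ℝ E := Module.Finite.equiv Φ.toLinearEquiv
  haveI : FiniteDimensional ℂ E := Module.Finite.of_restrictScalars_finite ℝ ℂ E
  have hxH : ((x : ↥(integralForms Φ (2 * p + 2))) : E [⋀^Fin (2 * p + 2)]→L[ℝ] ℂ) ∈ integralHodgeClassesIn Φ (2 * p + 2) (p + 1) :=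
    AddSubgroup.mem_addSubgroupOf.1 x.2
  have Hdec := hd.exists_nsmul_eq_primitive_add_wedge_ofRealForm hη hkq hxH
  obtain ⟨N, hN, y₀, hy₀H, hy₀P, β, hβH, hdec⟩ := Hdec
  -- `y₀` as an element `z₀ ∈ P`
  let z₀ : ↥(AddSubgroup.toIntSubmodule ((integralHodgeClassesIn Φ (2 * p + 2) (p + 1)).addSubgroupOf (integralForms Φ (2 * p + 2)))) :=
    ⟨⟨y₀, hy₀H.1⟩, AddSubgroup.mem_addSubgroupOf.2 hy₀H⟩
  have hz₀P : z₀ ∈ P := (hP z₀).2 ((hd.mem_primitiveForms_iff_wedgePow_wedge_eq_zero hkq y₀).2 hy₀P)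
  -- the Lefschetz part `N·x − y₀ = β ∧ θ` lies in `P^⊥`
  have hw : (((N • x - z₀ : ↥(AddSubgroup.toIntSubmodule ((integralHodgeClassesIn Φ (2 * p + 2) (p + 1)).addSubgroupOf
        (integralForms Φ (2 * p + 2))))) : ↥(integralForms Φ (2 * p + 2))) : E [⋀^Fin (2 * p + 2)]→L[ℝ] ℂ) =
      ((⟨β, hβH.1⟩ : ↥(integralForms Φ (2 * p))) : E [⋀^Fin (2 * p)]→L[ℝ] ℂ).wedge (ofRealForm η : E [⋀^Fin 2]→L[ℝ] ℂ) := by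
    have h1 : (((N • x - z₀ : ↥(AddSubgroup.toIntSubmodule ((integralHodgeClassesIn Φ (2 * p + 2) (p + 1)).addSubgroupOf
        (integralForms Φ (2 * p + 2))))) : ↥(integralForms Φ (2 * p + 2))) : E [⋀^Fin (2 * p + 2)]→L[ℝ] ℂ) =
        N • ((x : ↥(integralForms Φ (2 * p + 2))) : E [⋀^Fin (2 * p + 2)]→L[ℝ] ℂ) - y₀ := rfl
    rw [h1, ← Nat.cast_smul_eq_nsmul ℂ N, hdec, add_sub_cancel_left]
  have hwO := hd.mem_orthogonal_primitive_of_eq_wedge_ofRealForm hη (show p + 1 + (p + 1) = 2 * p + 2 by omega) hkq hq hγ e hn hB hP hw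
  -- `B(y₀, y₀) = B(y₀, N·x) − B(y₀, N·x − y₀) = 0`
  have h₁ : B (z₀ : ↥(integralForms Φ (2 * p + 2))) (x : ↥(integralForms Φ (2 * p + 2))) = 0 :=
    (LinearMap.BilinForm.mem_orthogonal_iff.1 hx) z₀ hz₀P
  have h₂ : B (z₀ : ↥(integralForms Φ (2 * p + 2))) ((N • x - z₀ : ↥(AddSubgroup.toIntSubmodule ((integralHodgeClassesIn Φ (2 * p + 2)
      (p + 1)).addSubgroupOf (integralForms Φ (2 * p + 2))))) : ↥(integralForms Φ (2 * p + 2))) = 0 :=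
    (LinearMap.BilinForm.mem_orthogonal_iff.1 hwO) z₀ hz₀P
  have hzz : B (z₀ : ↥(integralForms Φ (2 * p + 2))) (z₀ : ↥(integralForms Φ (2 * p + 2))) = 0 := by
    have h3 : ((N • x - z₀ : ↥(AddSubgroup.toIntSubmodule ((integralHodgeClassesIn Φ (2 * p + 2) (p + 1)).addSubgroupOf
        (integralForms Φ (2 * p + 2))))) : ↥(integralForms Φ (2 * p + 2))) =
        N • (x : ↥(integralForms Φ (2 * p + 2))) - (z₀ : ↥(integralForms Φ (2 * p + 2))) := rfl
    rw [h3, map_sub, map_nsmul, h₁, smul_zero, zero_sub, neg_eq_zero] at h₂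
    exact h₂
  -- Hodge–Riemann over `ℤ`: `z₀ = 0`
  have hz0 : z₀ = 0 := by
    by_contra hne
    have hpos := hd.neg_one_pow_mul_apply_self_pos_of_primitive hη (show p + 1 + (p + 1) = 2 * p + 2 by omega) hkq hq hγ e hn hB hP
      hz₀P hne
    rw [hzz, mul_zero, mul_zero] at hpos
    exact lt_irrefl _ hpos
  have hy0 : y₀ = 0 := congrArg (fun z : ↥(AddSubgroup.toIntSubmodule ((integralHodgeClassesIn Φ (2 * p + 2) (p + 1)).addSubgroupOf
    (integralForms Φ (2 * p + 2)))) ↦ ((z : ↥(integralForms Φ (2 * p + 2))) : E [⋀^Fin (2 * p + 2)]→L[ℝ] ℂ)) hz0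
  refine ⟨N, hN, β, hβH, ?_⟩
  rw [hdec, hy0, zero_add]

/-- **`(θ ∧ H^{2p}(X, ℤ))^{sat} ∩ Hdgᵖ⁺¹(X, ℤ) ⊆ P^⊥`**: if a positive multiple of the integral Hodge class `x` is `β ∧ θ` with `β ∈ H^{2p}(X, ℤ)`, then
`x ∈ P^⊥` (`β ∧ θ ∈ P^⊥` by g46-#9, and `P^⊥` is saturated: `N·B(z, x) = 0 ⟹ B(z, x) = 0`).
[cite: VoisinHodgeI2002, §6.3.2 Lemma 6.31 (PDF p. 128)] [cite: Lange2023AbelianVarietiesComplex, §5.4.1 (5.22) (PDF p. 275)] -/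
theorem IsPolarizationType.mem_orthogonal_primitive_of_nsmul_eq_wedge_ofRealForm (hd : IsPolarizationType Φ η d)
    (hη : IsRiemannForm Φ η) (hkq : 2 * p + 2 + q = j + 2) (hq : q ≤ j + 2) {γ : E [⋀^Fin (2 * q)]→L[ℝ] ℂ}
    (hγ : wedgePow (ofRealForm η) q = ((q.factorial * ∏ i : Fin q, d (Fin.castLE hq i) : ℕ) : ℂ) • γ)
    (e : Fin n ≃ ι) (hn : 2 * p + 2 + (2 * q + (2 * p + 2)) = n) {B : BilinForm ℤ ↥(integralForms Φ (2 * p + 2))}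
    (hB : ∀ x y : ↥(integralForms Φ (2 * p + 2)),
      ((B x y : ℤ) : ℂ) = poincarePairing Φ e hn (x : E [⋀^Fin (2 * p + 2)]→L[ℝ] ℂ) (γ.wedge (y : E [⋀^Fin (2 * p + 2)]→L[ℝ] ℂ)))
    {P : Submodule ℤ ↥(AddSubgroup.toIntSubmodule ((integralHodgeClassesIn Φ (2 * p + 2) (p + 1)).addSubgroupOf (integralForms Φ (2 * p + 2))))}
    (hP : ∀ z, z ∈ P ↔ (((z : ↥(AddSubgroup.toIntSubmodule ((integralHodgeClassesIn Φ (2 * p + 2) (p + 1)).addSubgroupOf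
      (integralForms Φ (2 * p + 2))))) : ↥(integralForms Φ (2 * p + 2))) : E [⋀^Fin (2 * p + 2)]→L[ℝ] ℂ) ∈ primitiveForms η (2 * p + 2))
    {x : ↥(AddSubgroup.toIntSubmodule ((integralHodgeClassesIn Φ (2 * p + 2) (p + 1)).addSubgroupOf (integralForms Φ (2 * p + 2))))}
    {N : ℕ} (hN : 0 < N) {β : ↥(integralForms Φ (2 * p))}
    (hNx : (N : ℂ) • ((x : ↥(integralForms Φ (2 * p + 2))) : E [⋀^Fin (2 * p + 2)]→L[ℝ] ℂ) =
      (β : E [⋀^Fin (2 * p)]→L[ℝ] ℂ).wedge (ofRealForm η : E [⋀^Fin 2]→L[ℝ] ℂ)) :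
    x ∈ (B.restrict (AddSubgroup.toIntSubmodule ((integralHodgeClassesIn Φ (2 * p + 2) (p + 1)).addSubgroupOf
      (integralForms Φ (2 * p + 2))))).orthogonal P := by
  -- `N·x ∈ P^⊥` by g46-#9
  have hw : (((N • x : ↥(AddSubgroup.toIntSubmodule ((integralHodgeClassesIn Φ (2 * p + 2) (p + 1)).addSubgroupOf
        (integralForms Φ (2 * p + 2))))) : ↥(integralForms Φ (2 * p + 2))) : E [⋀^Fin (2 * p + 2)]→L[ℝ] ℂ) =
      (β : E [⋀^Fin (2 * p)]→L[ℝ] ℂ).wedge (ofRealForm η : E [⋀^Fin 2]→L[ℝ] ℂ) := by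
    rw [← hNx, Nat.cast_smul_eq_nsmul]
    rfl
  have hNO := hd.mem_orthogonal_primitive_of_eq_wedge_ofRealForm hη (show p + 1 + (p + 1) = 2 * p + 2 by omega) hkq hq hγ e hn hB hP hw
  rw [LinearMap.BilinForm.mem_orthogonal_iff] at hNO ⊢
  intro z hz
  have h := hNO z hz
  -- `B(z, N·x) = N·B(z, x) = 0`
  have h' : N • B (z : ↥(integralForms Φ (2 * p + 2))) (x : ↥(integralForms Φ (2 * p + 2))) = 0 := by
    rw [← map_nsmul]
    exact h
  exact (smul_eq_zero.1 h').resolve_left (by exact_mod_cast hN.ne')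

set_option maxHeartbeats 4000000 in
/-- **THE LEFSCHETZ PART OF THE INTEGRAL HODGE LATTICE IS THE SATURATION OF `θ ∧ Hdgᵖ(X, ℤ)`**: for `x ∈ Hdgᵖ⁺¹(X, ℤ)`,
`x ⟂ Hdgᵖ⁺¹(X, ℤ)_prim ⟺ ∃ N ≥ 1, ∃ β ∈ Hdgᵖ(X, ℤ), N·x = β ∧ θ` — the orthogonal Lefschetz decomposition of the Hodge classes
`Bᵖ⁺¹(X) = Bᵖ⁺¹(X)_prim ⊕ L Bᵖ(X)` read on the lattice. [cite: VoisinHodgeI2002, §6.3.2 Lemma 6.31, Thm. 6.32 (PDF p. 128); §6.2.3 Rem. 6.27; §7.1.2 (PDF p. 134)] [cite: Lange2023AbelianVarietiesComplex, §7.3.2 (3); §5.4.1 (5.22) (PDF p. 275)] -/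
theorem IsPolarizationType.mem_orthogonal_primitive_iff_exists_nsmul_eq_wedge_ofRealForm (hd : IsPolarizationType Φ η d)
    (hη : IsRiemannForm Φ η) (hkq : 2 * p + 2 + q = j + 2) (hq : q ≤ j + 2) {γ : E [⋀^Fin (2 * q)]→L[ℝ] ℂ}
    (hγ : wedgePow (ofRealForm η) q = ((q.factorial * ∏ i : Fin q, d (Fin.castLE hq i) : ℕ) : ℂ) • γ)
    (e : Fin n ≃ ι) (hn : 2 * p + 2 + (2 * q + (2 * p + 2)) = n) {B : BilinForm ℤ ↥(integralForms Φ (2 * p + 2))}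
    (hB : ∀ x y : ↥(integralForms Φ (2 * p + 2)),
      ((B x y : ℤ) : ℂ) = poincarePairing Φ e hn (x : E [⋀^Fin (2 * p + 2)]→L[ℝ] ℂ) (γ.wedge (y : E [⋀^Fin (2 * p + 2)]→L[ℝ] ℂ)))
    {P : Submodule ℤ ↥(AddSubgroup.toIntSubmodule ((integralHodgeClassesIn Φ (2 * p + 2) (p + 1)).addSubgroupOf (integralForms Φ (2 * p + 2))))}
    (hP : ∀ z, z ∈ P ↔ (((z : ↥(AddSubgroup.toIntSubmodule ((integralHodgeClassesIn Φ (2 * p + 2) (p + 1)).addSubgroupOf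
      (integralForms Φ (2 * p + 2))))) : ↥(integralForms Φ (2 * p + 2))) : E [⋀^Fin (2 * p + 2)]→L[ℝ] ℂ) ∈ primitiveForms η (2 * p + 2))
    (x : ↥(AddSubgroup.toIntSubmodule ((integralHodgeClassesIn Φ (2 * p + 2) (p + 1)).addSubgroupOf (integralForms Φ (2 * p + 2))))) :
    x ∈ (B.restrict (AddSubgroup.toIntSubmodule ((integralHodgeClassesIn Φ (2 * p + 2) (p + 1)).addSubgroupOf
        (integralForms Φ (2 * p + 2))))).orthogonal P ↔
      ∃ N : ℕ, 0 < N ∧ ∃ β ∈ integralHodgeClassesIn Φ (2 * p) p,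
        (N : ℂ) • ((x : ↥(integralForms Φ (2 * p + 2))) : E [⋀^Fin (2 * p + 2)]→L[ℝ] ℂ) = β.wedge (ofRealForm η : E [⋀^Fin 2]→L[ℝ] ℂ) := by
  refine ⟨fun hx ↦ hd.exists_nsmul_eq_wedge_ofRealForm_of_mem_orthogonal_primitive hη hkq hq hγ e hn hB hP hx, ?_⟩
  rintro ⟨N, hN, β, hβH, hNx⟩
  exact hd.mem_orthogonal_primitive_of_nsmul_eq_wedge_ofRealForm hη hkq hq hγ e hn hB hP hN (β := ⟨β, hβH.1⟩) hNx

end Saturation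

end Literature.Geometry.Kaehler.ComplexTorus

end
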